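import Mathlib.Analysis.Calculus.MeanValue
import Mathlib.Analysis.Calculus.Deriv.MeanValue
import Mathlib.Analysis.SpecialFunctions.Sqrt
import Mathlib.Order.Filter.AtTopBot.Basic
import Mathlib.Topology.Order.Basic

/-!
# Route EIHFluxBalance — `InertialRecession`, re-charting: the TILT ENVELOPE of a clock chart and the
# slack dichotomy (input `βᵢ` of the transfer …RechartTransfer3 and the lab-slab clause `βᵢRb ≤ slack`)

Helper file for the crux `stmt-FinalStateConjecture-10166`
(`Summit.FinalStateConjecture.FinalStateConjecture.Theses.EIHFluxBalance.InertialRecession`),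
stub `stub_rechart` (the transfer P2 of line `sublinear-is-free-clean-window-charges`), part G2.

For the Lorentz factor `u = ũ⁰ ∘ Λ̃` of a hole (`1 ≤ u ≤ γ`):
* `exists_tilt_envelope` — the envelope `β(t) = sup_{σ ≥ t/2} √(u(σ)² − 1)` of the slab tilt over the
  time window of a ball (antitone, `0 ≤ β ≤ γ`, dominates the tilt at every `σ ≥ t/2`, and `β → 0` if
  `u → 1`);
* `tendsto_one_of_slack_bddAbove` — if the slack `s` (`s' = 1 − u⁻¹`) is bounded above and `u` is
  eventually Lipschitz, then `u → 1` (every bump of `u − 1` of height `ε` adds `≥ ε²/(4Lγ)` to `s`);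
* `eventually_tilt_mul_le_slack` — the SLACK DICHOTOMY: for every fixed ball radius `n`, eventually
  `β(t)·n ≤ s(t) + s₀` (either `s → ∞` swamps `β ≤ γ`, or `s` is bounded, `u → 1`, `β → 0 < 1 ≤ s + s₀`).
[folklore real analysis]
-/

noncomputable section

set_option linter.dupNamespace false

open Set Filter Topology

namespace Summit.FinalStateConjecture.FinalStateConjecture.Theorems

/-! ### The envelope -/

/-- `√(u² − 1) ≤ γ` for `1 ≤ u ≤ γ`. [folklore] -/
theorem sqrt_sq_sub_one_le_of_le {u γ : ℝ} (h1 : 1 ≤ u) (huγ : u ≤ γ) : Real.sqrt (u ^ 2 - 1) ≤ γ := by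
  have hγ : 0 ≤ γ := zero_le_one.trans (h1.trans huγ)
  rw [Real.sqrt_le_left hγ]
  nlinarith

/-- **The tilt envelope.** See the module docstring. [folklore] -/
theorem exists_tilt_envelope {u : ℝ → ℝ} {γ : ℝ} (hu1 : ∀ t, 1 ≤ u t) (huγ : ∀ t, u t ≤ γ) :
    ∃ β : ℝ → ℝ, Antitone β ∧ (∀ t, 0 ≤ β t) ∧ (∀ t, β t ≤ γ) ∧
      (∀ t σ, t / 2 ≤ σ → Real.sqrt (u σ ^ 2 - 1) ≤ β t) ∧
      (Tendsto u atTop (𝓝 1) → Tendsto β atTop (𝓝 0)) := by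
  set f : ℝ → ℝ := fun σ ↦ Real.sqrt (u σ ^ 2 - 1) with hf
  have hfγ : ∀ σ, f σ ≤ γ := fun σ ↦ sqrt_sq_sub_one_le_of_le (hu1 σ) (huγ σ)
  have hf0 : ∀ σ, 0 ≤ f σ := fun σ ↦ Real.sqrt_nonneg _
  have hbdd : ∀ t, BddAbove (f '' Ici (t / 2)) := fun t ↦ ⟨γ, by rintro _ ⟨σ, -, rfl⟩; exact hfγ σ⟩
  have hne : ∀ t, (f '' Ici (t / 2)).Nonempty := fun t ↦ ⟨f (t / 2), t / 2, self_mem_Ici, rfl⟩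
  set β : ℝ → ℝ := fun t ↦ sSup (f '' Ici (t / 2)) with hβ
  have hle : ∀ t σ, t / 2 ≤ σ → f σ ≤ β t := fun t σ hσ ↦ le_csSup (hbdd t) ⟨σ, hσ, rfl⟩
  have hβle : ∀ t b, (∀ σ, t / 2 ≤ σ → f σ ≤ b) → β t ≤ b := fun t b h ↦
    csSup_le (hne t) (by rintro _ ⟨σ, hσ, rfl⟩; exact h σ hσ)
  refine ⟨β, fun t t' htt' ↦ ?_, fun t ↦ (hf0 _).trans (hle t (t / 2) le_rfl), fun t ↦ hβle t γ fun σ _ ↦ hfγ σ,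
    hle, fun hu ↦ ?_⟩
  · exact csSup_le_csSup (hbdd t) (hne t') (image_mono (Ici_subset_Ici.mpr (by linarith)))
  · -- `f → 0`, hence the envelope
    have hf_lim : Tendsto f atTop (𝓝 0) := by
      have h1 : Tendsto (fun σ ↦ u σ ^ 2 - 1) atTop (𝓝 0) := by
        have := (hu.pow 2).sub_const 1
        rwa [one_pow, sub_self] at this
      have h2 := h1.sqrt
      rwa [Real.sqrt_zero] at h2
    rw [Metric.tendsto_atTop] at hf_lim ⊢
    intro ε hε
    obtain ⟨T, hT⟩ := hf_lim (ε / 2) (half_pos hε)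
    refine ⟨2 * T, fun t ht ↦ ?_⟩
    have hβt : β t ≤ ε / 2 := hβle t _ fun σ hσ ↦ by
      have h := hT σ (by linarith)
      rw [Real.dist_eq, sub_zero, abs_of_nonneg (hf0 σ)] at h
      exact h.le
    rw [Real.dist_eq, sub_zero, abs_of_nonneg ((hf0 _).trans (hle t (t / 2) le_rfl))]
    linarith

/-! ### Bounded slack forces the Lorentz factor to `1` -/

/-- **Bounded slack ⇒ `u → 1`.** See the module docstring. [folklore] -/
theorem tendsto_one_of_slack_bddAbove {u s : ℝ → ℝ} {γ L T₁ B : ℝ} (hu1 : ∀ t, 1 ≤ u t)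
    (huγ : ∀ t, u t ≤ γ) (hL : 0 < L)
    (hlip : ∀ t t', T₁ ≤ t → T₁ ≤ t' → |u t - u t'| ≤ L * |t - t'|)
    (hs : ∀ t, HasDerivAt s (1 - (u t)⁻¹) t) (hB : ∀ t, s t ≤ B) :
    Tendsto u atTop (𝓝 1) := by
  have hγ1 : 1 ≤ γ := (hu1 0).trans (huγ 0)
  have hγ : 0 < γ := one_pos.trans_le hγ1
  have hsd : Differentiable ℝ s := fun t ↦ (hs t).differentiableAt
  have hs' : ∀ t, deriv s t = 1 - (u t)⁻¹ := fun t ↦ (hs t).deriv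
  have hrate : ∀ t, (u t - 1) / γ ≤ deriv s t := fun t ↦ by
    rw [hs']
    have hu : 0 < u t := one_pos.trans_le (hu1 t)
    rw [show 1 - (u t)⁻¹ = (u t - 1) / u t by field_simp]
    exact div_le_div_of_nonneg_left (by linarith [hu1 t]) hu (huγ t)
  have hmono : Monotone s := monotone_of_deriv_nonneg hsd fun t ↦
    le_trans (div_nonneg (by linarith [hu1 t]) hγ.le) (hrate t)
  by_contra hnot
  -- a height `ε` reached frequently
  obtain ⟨ε, hε, hfreq⟩ : ∃ ε : ℝ, 0 < ε ∧ ∀ N : ℝ, ∃ t, N ≤ t ∧ ε ≤ u t - 1 := by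
    by_contra hall
    push Not at hall
    apply hnot
    rw [Metric.tendsto_atTop]
    intro ε hε
    obtain ⟨N, hN⟩ := hall ε hε
    refine ⟨N, fun t ht ↦ ?_⟩
    rw [Real.dist_eq, abs_of_nonneg (by linarith [hu1 t])]
    exact hN t ht
  -- each bump adds `c` to the slack
  set δ : ℝ := ε / (2 * L) with hδ
  have hδpos : 0 < δ := by positivity
  set c : ℝ := ε / 2 / γ * δ with hc
  have hcpos : 0 < c := by positivity
  have hbump : ∀ t, T₁ ≤ t → ε ≤ u t - 1 → s t + c ≤ s (t + δ) := by
    intro t ht hεt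
    have hlow : ∀ x ∈ interior (Icc t (t + δ)), ε / 2 / γ ≤ deriv s x := by
      intro x hx
      rw [interior_Icc] at hx
      have h1 : |u x - u t| ≤ L * |x - t| := hlip x t (ht.trans hx.1.le) ht
      rw [abs_of_nonneg (by linarith [hx.1] : (0 : ℝ) ≤ x - t)] at h1
      have h2 : L * (x - t) ≤ L * δ := mul_le_mul_of_nonneg_left (by linarith [hx.2]) hL.le
      have h3 : L * δ = ε / 2 := by rw [hδ]; field_simp
      have h4 : ε / 2 ≤ u x - 1 := by
        have := neg_abs_le (u x - u t); linarith
      exact le_trans (div_le_div_of_nonneg_right h4 hγ.le) (hrate x)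
    have h := (convex_Icc t (t + δ)).mul_sub_le_image_sub_of_le_deriv hsd.continuous.continuousOn
      (hsd.differentiableOn.mono interior_subset) hlow t (left_mem_Icc.mpr (by linarith)) (t + δ)
      (right_mem_Icc.mpr (by linarith)) (by linarith)
    rw [add_sub_cancel_left] at h
    rw [hc]; linarith
  -- iterate: `s` exceeds every bound
  have hiter : ∀ k : ℕ, ∃ t, T₁ ≤ t ∧ s T₁ + k * c ≤ s t := by
    intro k
    induction k with
    | zero => exact ⟨T₁, le_rfl, by simp⟩
    | succ k ih =>
      obtain ⟨t, ht, hk⟩ := ih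
      obtain ⟨t', ht', hε'⟩ := hfreq (max t T₁)
      have ht'T : T₁ ≤ t' := (le_max_right _ _).trans ht'
      have ht't : t ≤ t' := (le_max_left _ _).trans ht'
      refine ⟨t' + δ, by linarith, ?_⟩
      have h1 := hbump t' ht'T hε'
      have h2 := hmono ht't
      push_cast
      linarith
  obtain ⟨k, hk⟩ := exists_nat_gt ((B - s T₁) / c)
  obtain ⟨t, -, ht⟩ := hiter k
  have h1 : (k : ℝ) * c ≤ B - s T₁ := by linarith [hB t]
  rw [div_lt_iff₀ hcpos] at hk
  linarith

/-! ### The slack dichotomy -/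

/-- **The slack dichotomy.** See the module docstring. [folklore] -/
theorem eventually_tilt_mul_le_slack {u s β : ℝ → ℝ} {γ L T₁ s₀ T : ℝ} (hu1 : ∀ t, 1 ≤ u t)
    (huγ : ∀ t, u t ≤ γ) (hL : 0 < L)
    (hlip : ∀ t t', T₁ ≤ t → T₁ ≤ t' → |u t - u t'| ≤ L * |t - t'|)
    (hs : ∀ t, HasDerivAt s (1 - (u t)⁻¹) t) (hβγ : ∀ t, β t ≤ γ)
    (hβlim : Tendsto u atTop (𝓝 1) → Tendsto β atTop (𝓝 0))
    (hs₀ : ∀ t, T ≤ t → 1 ≤ s t + s₀) {n : ℝ} (hn : 0 ≤ n) :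
    ∀ᶠ t in atTop, β t * n ≤ s t + s₀ := by
  have hγ1 : 1 ≤ γ := (hu1 0).trans (huγ 0)
  have hγ : 0 < γ := one_pos.trans_le hγ1
  have hsd : Differentiable ℝ s := fun t ↦ (hs t).differentiableAt
  have hmono : Monotone s := monotone_of_deriv_nonneg hsd fun t ↦ by
    rw [(hs t).deriv, sub_nonneg]
    exact inv_le_one_of_one_le₀ (hu1 t)
  by_cases hbdd : ∃ B, ∀ t, s t ≤ B
  · -- bounded slack: the tilt dies
    obtain ⟨B, hB⟩ := hbdd
    have hβ := hβlim (tendsto_one_of_slack_bddAbove hu1 huγ hL hlip hs hB)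
    have hev : ∀ᶠ t in atTop, β t ≤ 1 / (n + 1) :=
      (hβ.eventually (eventually_le_nhds (by positivity))).mono fun t h ↦ h
    filter_upwards [hev, eventually_ge_atTop T] with t ht htT
    have h1 : β t * n ≤ 1 / (n + 1) * n := mul_le_mul_of_nonneg_right ht hn
    have h2 : 1 / (n + 1) * n ≤ 1 := by
      rw [div_mul_eq_mul_div, one_mul, div_le_one (by positivity)]; linarith
    linarith [hs₀ t htT]
  · -- unbounded slack swamps the bounded tilt
    push Not at hbdd
    have hstop : Tendsto s atTop atTop :=
      hmono.tendsto_atTop_atTop fun b ↦ let ⟨t, ht⟩ := hbdd b; ⟨t, ht.le⟩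
    filter_upwards [hstop.eventually (eventually_ge_atTop (γ * n - s₀))] with t ht
    have h1 : β t * n ≤ γ * n := mul_le_mul_of_nonneg_right (hβγ t) hn
    linarith

/-- **Eventual Lipschitz bound from a decaying derivative.** If `u` is differentiable and `u' → 0`,
there is `T₁` with `|u t − u t'| ≤ 1·|t − t'|` for `t, t' ≥ T₁`. [folklore] -/
theorem exists_lipschitz_of_tendsto_deriv {u : ℝ → ℝ} (hud : Differentiable ℝ u)
    (hu' : Tendsto (deriv u) atTop (𝓝 0)) :
    ∃ T₁ : ℝ, ∀ t t', T₁ ≤ t → T₁ ≤ t' → |u t - u t'| ≤ 1 * |t - t'| := by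
  obtain ⟨T₁, hT₁⟩ := (hu'.eventually (Metric.ball_mem_nhds 0 one_pos)).exists_forall_of_atTop
  refine ⟨T₁, fun t t' ht ht' ↦ ?_⟩
  have h := (convex_Ici T₁).norm_image_sub_le_of_norm_deriv_le (fun x _ ↦ hud x)
    (fun x hx ↦ (mem_ball_zero_iff.mp (hT₁ x hx)).le) ht' ht
  rw [Real.norm_eq_abs, Real.norm_eq_abs] at h
  exact h

/-- Registered one-line form (stub `sqrt_sq_sub_one_le_of_le_rechart` of the crux item) of
`sqrt_sq_sub_one_le_of_le`. [folklore] -/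
theorem sqrt_sq_sub_one_le_of_le_rechart : ∀ {u γ : ℝ}, 1 ≤ u → u ≤ γ → Real.sqrt (u ^ 2 - 1) ≤ γ :=
  fun h1 huγ ↦ sqrt_sq_sub_one_le_of_le h1 huγ

end Summit.FinalStateConjecture.FinalStateConjecture.Theorems
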